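import Summits.AtomisticToContinuum.Crystallization.Theorems.OverbindingBudgetAffineFarCoreCertificateA

/-!
# «CertificateInterface» (lens-4 g64, 31280 slot Z) — part B (sequel of `…OverbindingBudgetAffineFarCoreCertificateA`)

Split for the 400-line cap by the landing lane (hand-2 g29); the module docstring of part A describes the whole node.  Same namespace; all FQNs unchanged.
0 sorry; standard axioms.
-/


namespace Summit.AtomisticToContinuum.Crystallization.Theorems.OverbindingBudgetAffineFarSmoothSplit

local notation "E3" => EuclideanSpace ℝ (Fin 3)
open scoped BigOperators Classical
open Literature.MathematicalPhysics.StatisticalMechanics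

/-! ## §5 Assembly: `FarCoreExcess ⟸ HcpEnergyUpper ∧ CoreFarShapeBound` -/

/-- **Z2-U · `HcpEnergyUpper u`**: `u` bounds the Lennard-Jones ground-state energy per particle from ABOVE (`e⋆ ≤ u`) — e.g. a truncated hcp lattice
sum at the reference chart (the dropped tail terms are negative). [ATTACKABLE·S] -/
def HcpEnergyUpper (u : ℝ) : Prop :=
  (⨅ Q : PeriodicConfiguration 3, Q.energyPerParticle lennardJones) ≤ u

/-- **Z2-S · `CoreFarShapeBound θ θ₀ Φ τ`**: every `θ`-admissible chart that is pattern-far at slack `τ` satisfies the SCALE-FREE shape inequality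
`shapeSix² ≤ 24 Φ · shapeTwelve` (equivalently `−shapeSix²/(24 shapeTwelve) ≥ −Φ`: the scale-optimised site energy is `≥ −Φ`).  This is the
5-dimensional statement the table certifies window by window. [CERT] -/
def CoreFarShapeBound (θ θ₀ Φ τ : ℝ) : Prop :=
  ∀ c : Chart, ChartAdmissible θ c → PatternFar θ₀ τ c → shapeSix c ^ 2 ≤ 24 * Φ * shapeTwelve c

/-- ★ **Z2 from the shape bound**: `HcpEnergyUpper u ∧ CoreFarShapeBound θ θ₀ (−(u + κ + m)) τ ⇒ FarCoreExcess θ θ₀ κ` (`θ ≤ 1/18`, `m, τ > 0`). [this file] -/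
theorem farCoreExcess_of_shapeBound {θ θ₀ κ u m τ : ℝ} (hθ : θ ≤ 1 / 18) (hm : 0 < m) (hτ : 0 < τ) (hU : HcpEnergyUpper u)
    (hS : CoreFarShapeBound θ θ₀ (-(u + κ + m)) τ) : FarCoreExcess θ θ₀ κ := by
  refine ⟨m, τ, hm, hτ, fun c hc hfar => ?_⟩
  have h := le_refEnergy_of_sq_le hθ hc (hS c hc hfar)
  rw [neg_neg] at h
  unfold HcpEnergyUpper at hU
  linarith

/-- ★ **Z2-S from a WINDOW REDUCTION plus per-window certificates** (abstract in the window/shape types): it suffices that every admissible far chart is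
assigned a window `w` and a shape point `x` in the certified region `Good w` with `shapeSix c ≤ T3up w x` (UPPER bound — far layers by coset MAX) and
`T6lo w x ≤ shapeTwelve c` (LOWER bound — far layers by coset MIN), and that the table certifies `T3up² ≤ 24 Φ T6lo` on `Good`. [this file] -/
theorem coreFarShapeBound_of_windows {θ θ₀ Φ τ : ℝ} {W Sh : Type*} (Good : W → Sh → Prop) (T3up T6lo : W → Sh → ℝ) (hΦ : 0 ≤ Φ)
    (hred : ∀ c : Chart, ChartAdmissible θ c → PatternFar θ₀ τ c →
      ∃ w x, Good w x ∧ shapeSix c ≤ T3up w x ∧ T6lo w x ≤ shapeTwelve c)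
    (hcert : ∀ w x, Good w x → T3up w x ^ 2 ≤ 24 * Φ * T6lo w x) : CoreFarShapeBound θ θ₀ Φ τ := by
  intro c hc hfar
  obtain ⟨w, x, hg, h3, h6⟩ := hred c hc hfar
  have h0 : 0 ≤ shapeSix c := by
    unfold shapeSix
    exact tsum_nonneg fun p => by positivity
  have h1 : shapeSix c ^ 2 ≤ T3up w x ^ 2 := pow_le_pow_left₀ h0 h3 2
  have h2 : 24 * Φ * T6lo w x ≤ 24 * Φ * shapeTwelve c := mul_le_mul_of_nonneg_left h6 (by positivity)
  exact h1.trans ((hcert w x hg).trans h2)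

/-- ★ **Record corollary** at the record constants `(θ, θ₀, κ) = (1/25, 1/2000, 1/(2·10⁷))`, margin `m = 10⁻⁹`: the hcp upper bound `u` and the shape
certificate at level `Φ = −(u + 1/(2·10⁷) + 10⁻⁹)` give Z2. [this file] -/
theorem farCoreExcess_record_of_certificate {u τ : ℝ} (hτ : 0 < τ) (hU : HcpEnergyUpper u)
    (hS : CoreFarShapeBound (1 / 25) (1 / 2000) (-(u + 1 / (2 * 10 ^ 7) + 1 / 10 ^ 9)) τ) :
    FarCoreExcess (1 / 25) (1 / 2000) (1 / (2 * 10 ^ 7)) :=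
  farCoreExcess_of_shapeBound (by norm_num) (by norm_num : (0:ℝ) < 1 / 10 ^ 9) hτ hU hS

/-! ## §6 Row kernels over ℚ (the `decide` side) and their soundness — rows (X2) and (N); the table supplies the numbers -/

/-- Row (X2) data: annulus radii `r₀ ≤ r₁`, model constants `e₀, g, λ, c₃`, curvature share `η`, claimed floor `φ` (all rational). -/
structure X2Row where
  r0 : ℚ
  r1 : ℚ
  e0 : ℚ
  g : ℚ
  lam : ℚ
  c3 : ℚ
  eta : ℚ
  phi : ℚ
  deriving DecidableEq

/-- Row (X2) kernel: the scalar side conditions of `annulus_lower` and the claimed floor, decided in ℚ. -/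
def x2Check (ρ : X2Row) : Bool :=
  (0 ≤ ρ.r0) && (0 ≤ ρ.c3) && (ρ.c3 * ρ.r1 ≤ ρ.eta * (ρ.lam / 2)) && (ρ.eta ≤ 1) && (0 ≤ ρ.lam) &&
    (ρ.g ≤ (1 - ρ.eta) * ρ.lam * ρ.r0) && (ρ.phi ≤ ρ.e0 - ρ.g * ρ.r0 + (1 - ρ.eta) * (ρ.lam / 2) * ρ.r0 ^ 2)

/-- ★ **Row (X2) soundness**: a passing row plus the window's QUADRATIC-MODEL FACT (`f ≥ e₀ − g‖E‖ + (λ/2)‖E‖² − c₃‖E‖³` on `‖E‖ ≤ r₁`, the hands'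
moment enclosures) give `f ≥ φ` on the annulus `r₀ ≤ ‖E‖ ≤ r₁`. [this file] -/
theorem x2Check_sound {V : Type*} [SeminormedAddCommGroup V] (f : V → ℝ) (ρ : X2Row) (hρ : x2Check ρ = true)
    (hmodel : ∀ E : V, ‖E‖ ≤ (ρ.r1 : ℝ) →
      (ρ.e0 : ℝ) - (ρ.g : ℝ) * ‖E‖ + (ρ.lam : ℝ) / 2 * ‖E‖ ^ 2 - (ρ.c3 : ℝ) * ‖E‖ ^ 3 ≤ f E) :
    ∀ E : V, (ρ.r0 : ℝ) ≤ ‖E‖ → ‖E‖ ≤ (ρ.r1 : ℝ) → (ρ.phi : ℝ) ≤ f E := by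
  simp only [x2Check, Bool.and_eq_true, decide_eq_true_eq] at hρ
  obtain ⟨⟨⟨⟨⟨⟨h1, h2⟩, h3⟩, h4⟩, h5⟩, h6⟩, h7⟩ := hρ
  intro E hE0 hE1
  have key := annulus_lower f (r₀ := (ρ.r0 : ℝ)) (r₁ := (ρ.r1 : ℝ)) (e₀ := (ρ.e0 : ℝ)) (g := (ρ.g : ℝ)) (lam := (ρ.lam : ℝ))
    (c₃ := (ρ.c3 : ℝ)) (η := (ρ.eta : ℝ)) (by exact_mod_cast h1) hmodel (by exact_mod_cast h2)
    (by exact_mod_cast h3) (by exact_mod_cast h4) (by exact_mod_cast h5) (by exact_mod_cast h6) E hE0 hE1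
  have h7' : (ρ.phi : ℝ) ≤ (ρ.e0 : ℝ) - (ρ.g : ℝ) * ρ.r0 + (1 - (ρ.eta : ℝ)) * ((ρ.lam : ℝ) / 2) * (ρ.r0 : ℝ) ^ 2 := by
    exact_mod_cast h7
  exact h7'.trans key

/-- Demo row (hcp h-centre window, memo §1 numbers: `r₀ = 1.5·10⁻⁴`, `r₁ = 1.4·10⁻³`, `λ = 5.37`, `c₃ = 283`, `η = 0.15`, `|g| = 3·10⁻⁷`,
`e₀ = 0` (excess normalisation), floor `φ = 5.13·10⁻⁸ ≥ κ + m = 5.1·10⁻⁸`): the ℚ kernel evaluates by `norm_num` (ℚ literals block kernel `decide`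
through `Nat.gcd`; the production table is integer-scaled — the FixedPointInterval encoding of (E0) — so that `decide` applies, with the same soundness
lemma up to casts). -/
example : x2Check ⟨3 / 20000, 7 / 5000, 0, 3 / 10000000, 537 / 100, 283, 3 / 20, 513 / 10000000000⟩ = true := by
  norm_num [x2Check]

/-- Row (N) kernel: for the two-shell family, defects `δ_k ≥ ‖X₀ w_k − w_k‖` and norms `n_k ≥ ‖w_k‖` (rational upper bounds), radius `r`, threshold `θ′`:
check `0 ≤ r`, `0 ≤ θ′` and `δ_k + 2 r n_k + θ′ r ≤ θ′` for every `k`. -/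
def nCheck (θ' r : ℚ) (rows : List (ℚ × ℚ)) : Bool :=
  (0 ≤ r) && (0 ≤ θ') && rows.all fun dn => dn.1 + 2 * r * dn.2 + θ' * r ≤ θ'

/-- ★ **Row (N) soundness**: a passing row, a shape `X` within operator distance `r` of the reference `X₀` (first shell `S` of unit vectors with
`min ‖X₀ S·‖ = 1`, nearest distance `μ = min ‖X S·‖`) and the defect/norm enclosures of the two-shell family `W` indexed by the row list ⇒ no `W k`
witnesses `θ′`-farness. [this file] -/
theorem nCheck_sound {ι : Type*} {S : ι → E3} (hS : ∀ i, ‖S i‖ = 1) {θ' r : ℚ} {rows : List (ℚ × ℚ)} (hρ : nCheck θ' r rows = true)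
    {W : Fin rows.length → E3} {X X₀ : E3 →L[ℝ] E3} {μ : ℝ} (hX : ‖X - X₀‖ ≤ (r : ℝ)) (hμle : ∀ i, μ ≤ ‖X (S i)‖)
    (hμeq : ∃ i, μ = ‖X (S i)‖) (h1le : ∀ i, 1 ≤ ‖X₀ (S i)‖) (h1eq : ∃ i, ‖X₀ (S i)‖ = 1)
    (hδ : ∀ k, ‖X₀ (W k) - W k‖ ≤ ((rows.get k).1 : ℝ)) (hn : ∀ k, ‖W k‖ ≤ ((rows.get k).2 : ℝ)) :
    ∀ k, ‖X (W k) - μ • W k‖ ≤ (θ' : ℝ) * μ := by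
  simp only [nCheck, Bool.and_eq_true, decide_eq_true_eq, List.all_eq_true] at hρ
  obtain ⟨⟨hr, hθ⟩, hall⟩ := hρ
  have hr' : (0 : ℝ) ≤ r := by exact_mod_cast hr
  have hθr : (0 : ℝ) ≤ θ' := by exact_mod_cast hθ
  refine not_farShape_of_near hS hX hμle hμeq h1le h1eq hθr fun k => ?_
  have hk := hall (rows.get k) (List.get_mem rows k)
  have hk' : ((rows.get k).1 : ℝ) + 2 * (r : ℝ) * ((rows.get k).2 : ℝ) + (θ' : ℝ) * r ≤ θ' := by exact_mod_cast hk
  have h2 : 2 * (r : ℝ) * ‖W k‖ ≤ 2 * (r : ℝ) * ((rows.get k).2 : ℝ) := mul_le_mul_of_nonneg_left (hn k) (by positivity)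
  linarith [hδ k]

/-- Demo row (N) (hcp window, crude constants of memo §1: `θ′ = 4.99·10⁻⁴`, operator radius `r = 1.35·10⁻⁴`, worst defect `1.151·10⁻⁴` at `‖w‖ ≤ 1.4143`;
in-plane vectors defect `0`): evaluated by `norm_num`. -/
example : nCheck (499 / 1000000) (27 / 200000) [(1151 / 10000000, 14143 / 10000), (0, 14143 / 10000), (0, 1)] = true := by
  norm_num [nCheck]

end Summit.AtomisticToContinuum.Crystallization.Theorems.OverbindingBudgetAffineFarSmoothSplit

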